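/-
Copyright (c) 2026 the pub-hodgecm-mathlib formalisation cell (harness21).  Prover seat hodgecm-mathlib-K2E4-p10 (g6), Track B ∕ K2-LIT, h413 =
`stmt-HodgeConjecture-24833`, line `K2_E1_TraceFormulaBeta`, campaign «EIS-R7-BL-SPH-3», (RES) letter payer (P-orth) of ★ p859418 — the tube orthogonality at `U(2,1)` over a CM field
(dealer K2E1-plan (g6) (89), 2026-09-04T10:42:29Z).
-/
import Summits.HodgeConjecture.HodgeConjecture.Theorems.K2E1SphericalEisensteinResidueOrthogonalU        -- THIS SEAT (generic part): §2 Siegel one-term bound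
import Summits.HodgeConjecture.HodgeConjecture.Theorems.K2E1CuspFormsMeanZeroSoftUCM                  -- ★ p859288 (this seat): the CM discharge pattern; brings ★ FILE A∕B, (β1), `map_conj_toAdelic_eq_self_three`, (ν-2), unimodularity
import Summits.HodgeConjecture.HodgeConjecture.Theorems.K2E1SphericalEisensteinContinuationU3Final     -- ★ (K2E3-p11 g9): `borelConstantTerm_sphericalEisenstein_cm_three` (the constant term on the tube); brings ★ `truncation_eisensteinSeriesU_eq_three`, Godement
import Summits.HodgeConjecture.HodgeConjecture.Theorems.K2E1SphericalHeckeEigenSectionU2               -- ★ ℓ9 (K2E1-p10): `norm_borelHeight_cpow`, `continuous_borelHeight_cpow`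
import HarnessLib

/-!
# K2·E1 — `K2E1TruncatedEisensteinCuspOrthogonalCMThree` ((RES) payer (P-orth), tube part, `U(2,1)_{L/L⁺}`): **`⟪φ̂, [Λ^T E(φ₀H^z)]⟫ = 0` FOR EVERY CUSP FORM `φ`, `2 < Re z`, `T ≥ 1`**

Track B ∕ K2-LIT, crux h413 = `stmt-HodgeConjecture-24833`, route of record `HCCMUnconditional`; cell `hodgecm-mathlib`, squad K2, ENGINE E1, campaign EIS-R7-BL-SPH-3 (R31).  Prover seat
`hodgecm-mathlib-K2E4-p10` (g6); RE-KEY (89) of the dealer K2E1-plan (g6).  THEOREMS ONLY (no `def`, no `instance`, no notation, no named-fact hypothesis, no `sorry`); lane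
`--supports stmt-HodgeConjecture-24833 --as helper` (count-neutral).  Closes no socket.

THE MATHEMATICS ([MoeglinWaldspurger1995, IV.1.11 with II.1.8 and I.2.13]; [BernsteinLapid2019, §4 Claim 2]).  On the Godement tube `2 < Re z` the truncated Eisenstein series splits as
`Λ^T E(f_z) = E(𝟙_{H≤T} f_z) − E(𝟙_{H>T} φ₀ c(z) H^{2−z})` (★ `truncation_eisensteinSeriesU_eq_three`, the constant term ★ `borelConstantTerm_sphericalEisenstein_cm_three`), two Eisenstein
series of Borel left-`N(𝔸)B(L⁺)`-invariant functions whose majorant series are controlled — `θ(‖𝟙_{H≤T}f_z‖) ≤ ‖Λ^T E(f_{Re z})‖ + ‖φ₀ c(Re z)‖` (§1: the SAME split at the real point, all terms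
being `φ₀ ×` non-negative reals) and `θ(‖𝟙_{H>T}φ₀c(z)H^{2−z}‖) ≤ ‖φ₀ c(z)‖` (one coset above the floor, ★ generic §2) — so ★ FILE A («`E(f) ⊥ Λ` when `Λ_B ≡ 0`»,
`K2E1BLEisensteinCuspOrthogonalU`) applies to both against the lift `Λ = invQuot φ` of a cusp form (★ (β1)), its `L¹` letter discharged by ★ FILE B from `Λ^T E(f_{Re z}) ∈ L²` and
`φ ∈ L²` (Hölder): **`inner_cuspFormsToLp_eq_zero_of_ae_eq_truncation_cm_three` — `⟪φ̂, v⟫ = 0` for every `L²` class `v =ᵐ Λ^T E(f_z)`** (the (Tr) letter `Λ^T E(f_{Re z}) ∈ L²(μ)` at the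
REAL point is the one hypothesis).  Consumer: ★ `K2E1SphericalEisensteinResidueOrthogonalCMThree.horth_cm_three_of_letters` (this seat).
HONEST LABEL: HC_CM is proved only modulo the 7 printed citations (2 remaining named inputs: hLiu418 = `stmt-HodgeConjecture-24832`, h413 = `stmt-HodgeConjecture-24833`) until rung 0
closes; this file asserts no named fact and closes no socket.
References: [MoeglinWaldspurger1995] I.2.13, II.1.8, IV.1.11 · [BernsteinLapid2019] §4 p. 10 · [Garrett2018] §2.10–§2.11 · [BorelJacquet1979] §4.4–§4.6.
-/


set_option autoImplicit false
-- the mandated namespace repeats the single-problem summit's segment (`HodgeConjecture.HodgeConjecture`)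
set_option linter.dupNamespace false

noncomputable section

open MeasureTheory Measure NumberField IsDedekindDomain Set Filter Topology MulAction
open scoped ENNReal NNReal InnerProductSpace ComplexConjugate
open Literature.MeasureTheory.Group Literature.NumberTheory
open Literature.NumberTheory.Automorphic Literature.NumberTheory.Automorphic.UnitaryGroup AdelicGroupData
open Summit.HodgeConjecture.HodgeConjecture.Cruxes.H413.K2E1BorelEisensteinU
open Summit.HodgeConjecture.HodgeConjecture.Cruxes.H413.K2E1BorelCosetsDictionary (eisensteinSeriesU_eq_tsum_arithmeticBorelQuot)
open Summit.HodgeConjecture.HodgeConjecture.Cruxes.H413.K2E1TruncatedEisensteinExplicit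
open Summit.HodgeConjecture.HodgeConjecture.Cruxes.H413.K2E1MaassSelbergBracketsThree (measurable_flatSectionU)
open Summit.HodgeConjecture.HodgeConjecture.Cruxes.H413.K2E1BLEisensteinCuspOrthogonalU
open Summit.HodgeConjecture.HodgeConjecture.Cruxes.H413.K2E1BLEisensteinInWeightedSpaceU2 (lintegral_weight_enorm_mul_lt_top_of_lintegral_quotient_lt_top exists_isCoveringWeight_arithmeticBorel)
open Summit.HodgeConjecture.HodgeConjecture.Cruxes.H413.K2E1CuspConditionDictionaryU (invQuot_package_of_mem_cuspForms)
open Summit.HodgeConjecture.HodgeConjecture.Cruxes.H413.K2E1SphericalEisensteinContinuationU3Final (borelConstantTerm_sphericalEisenstein_cm_three)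
open Summit.HodgeConjecture.HodgeConjecture.Cruxes.H413.K2E1BorelEisensteinGodementCMThree (summable_eisensteinSeriesU_flatSectionU_cm_three)
open Summit.HodgeConjecture.HodgeConjecture.Cruxes.H413.K2E1SphericalHeckeEigenSectionU2 (norm_borelHeight_cpow continuous_borelHeight_cpow borelHeight_coe_pos)
open Summit.HodgeConjecture.HodgeConjecture.Cruxes.H413.K2E1BLBorelSpacesU2Defs
open Summit.HodgeConjecture.HodgeConjecture.Cruxes.H413.K2E1SphericalEisensteinResidueOrthogonalU

namespace Summit.HodgeConjecture.HodgeConjecture.Cruxes.H413.K2E1TruncatedEisensteinCuspOrthogonalCMThree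

variable (L : Type) [Field L] [NumberField L] [IsCMField L]
variable [MeasurableSpace (quasiSplit (↥(maximalRealSubfield L)) L (IsCMField.complexConj L) 3).Adelic] [BorelSpace (quasiSplit (↥(maximalRealSubfield L)) L (IsCMField.complexConj L) 3).Adelic]

/-! ## §1 On the tube: `⟪φ̂, [Λ^T E(f_z)]⟫ = 0` for every cusp form `φ` -/

section Tube

/-- **THE MAJORANT OF THE LOW PART, `θ(‖𝟙_{H≤T} f_z‖)(y) ≤ ‖Λ^T E(f_{Re z})(y)‖ + C`** (`f_z = φ₀H^z`, `2 < Re z`, `T ≥ 1`; `C = ‖φ₀ c(Re z)‖ < ∞`): all terms are `φ₀ ×` non-negative reals, so the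
majorant series IS `‖E(𝟙_{H≤T} f_{Re z})(y)‖`, and `E(𝟙_{H≤T}f) = Λ^T E(f) + E(𝟙_{H>T} φ₀cH^{2−·})` (★ `truncation_eisensteinSeriesU_eq_three`) with the one-term bound ★.
[cite: MoeglinWaldspurger1995, I.2.13] [cite: Garrett2018, §2.11] -/
theorem exists_tsum_enorm_lowIndicator_le_cm_three (ν : Measure ↥(adelicUnipotent (↥(maximalRealSubfield L)) L (IsCMField.complexConj L) 3)) [ν.IsHaarMeasure]
    {𝓕 : Set ↥(adelicUnipotent (↥(maximalRealSubfield L)) L (IsCMField.complexConj L) 3)}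
    (h𝓕N : IsFundamentalDomain ↥(rationalUnipotent (↥(maximalRealSubfield L)) L (IsCMField.complexConj L) 3) 𝓕 ν) (h𝓕c : IsCompact (closure 𝓕))
    (φ₀ : ℂ) {T : ℝ≥0} (hT : 1 ≤ T) {z : ℂ} (hz : 2 < z.re) :
    ∃ C : ℝ≥0∞, C < ∞ ∧ ∀ y : (quasiSplit (↥(maximalRealSubfield L)) L (IsCMField.complexConj L) 3).Adelic,
      (∑' q : Quotient (QuotientGroup.rightRel (arithmeticBorel (↥(maximalRealSubfield L)) L (IsCMField.complexConj L) 3)),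
        ‖({g : (quasiSplit (↥(maximalRealSubfield L)) L (IsCMField.complexConj L) 3).Adelic | borelHeight g ≤ T}.indicator
            (flatSectionU (fun _ : (quasiSplit (↥(maximalRealSubfield L)) L (IsCMField.complexConj L) 3).Adelic => φ₀) z))
          (((q.out : (quasiSplit (↥(maximalRealSubfield L)) L (IsCMField.complexConj L) 3).arithmeticSubgroup) : (quasiSplit (↥(maximalRealSubfield L)) L (IsCMField.complexConj L) 3).Adelic) * y)‖ₑ) ≤
      ‖truncation ν 𝓕 T (eisensteinSeriesU (flatSectionU (fun _ : (quasiSplit (↥(maximalRealSubfield L)) L (IsCMField.complexConj L) 3).Adelic => φ₀) ((z.re : ℝ) : ℂ))) y‖ₑ + C := by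
  -- the real point `σ = Re z`
  set σ : ℝ := z.re with hσ
  have hσz : 2 < (((σ : ℝ) : ℂ)).re := by rwa [Complex.ofReal_re]
  set fσ : (quasiSplit (↥(maximalRealSubfield L)) L (IsCMField.complexConj L) 3).Adelic → ℂ :=
    flatSectionU (fun _ : (quasiSplit (↥(maximalRealSubfield L)) L (IsCMField.complexConj L) 3).Adelic => φ₀) ((σ : ℝ) : ℂ) with hfσ
  obtain ⟨cσ, hcσ⟩ : ∃ cσ : ℂ, ∀ g : (quasiSplit (↥(maximalRealSubfield L)) L (IsCMField.complexConj L) 3).Adelic,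
      borelConstantTerm ν 𝓕 (eisensteinSeriesU fσ) g = φ₀ * ((((borelHeight g : ℝ≥0) : ℝ) : ℂ) ^ ((σ : ℝ) : ℂ) + cσ * (((borelHeight g : ℝ≥0) : ℝ) : ℂ) ^ (2 - ((σ : ℝ) : ℂ))) :=
    ⟨_, fun g => borelConstantTerm_sphericalEisenstein_cm_three L ν h𝓕N h𝓕c φ₀ hσz g⟩
  set Mσ : (quasiSplit (↥(maximalRealSubfield L)) L (IsCMField.complexConj L) 3).Adelic → ℂ := fun g => φ₀ * cσ * (((borelHeight g : ℝ≥0) : ℝ) : ℂ) ^ (2 - ((σ : ℝ) : ℂ)) with hMσ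
  have hfσB : ∀ b ∈ arithmeticBorel (↥(maximalRealSubfield L)) L (IsCMField.complexConj L) 3, ∀ x : (quasiSplit (↥(maximalRealSubfield L)) L (IsCMField.complexConj L) 3).Adelic,
      fσ ((b : (quasiSplit (↥(maximalRealSubfield L)) L (IsCMField.complexConj L) 3).Adelic) * x) = fσ x := fun b hb x => by
    simp only [hfσ, flatSectionU_apply, K2E1TruncatedEisensteinExplicit.borelHeight_arithmeticBorel_mul hb]
  have hMσB : ∀ b ∈ arithmeticBorel (↥(maximalRealSubfield L)) L (IsCMField.complexConj L) 3, ∀ x : (quasiSplit (↥(maximalRealSubfield L)) L (IsCMField.complexConj L) 3).Adelic,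
      Mσ ((b : (quasiSplit (↥(maximalRealSubfield L)) L (IsCMField.complexConj L) 3).Adelic) * x) = Mσ x := fun b hb x => by
    simp only [hMσ, K2E1TruncatedEisensteinExplicit.borelHeight_arithmeticBorel_mul hb]
  have hCTσ : ∀ x : (quasiSplit (↥(maximalRealSubfield L)) L (IsCMField.complexConj L) 3).Adelic, T < borelHeight x →
      borelConstantTerm ν 𝓕 (eisensteinSeriesU fσ) x = fσ x + Mσ x := fun x _ => by
    rw [hcσ x, hfσ, flatSectionU_apply, hMσ]; ring
  -- the one-term bound for the tail `E(𝟙_{H>T} Mσ)`: `‖Mσ‖ ≤ ‖φ₀‖‖cσ‖` above `T ≥ 1` (`σ > 2`)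
  have hMσbd : ∀ g : (quasiSplit (↥(maximalRealSubfield L)) L (IsCMField.complexConj L) 3).Adelic, T < borelHeight g → ‖Mσ g‖ ≤ ‖φ₀‖ * ‖cσ‖ := fun g hg => by
    rw [hMσ]
    change ‖φ₀ * cσ * (((borelHeight g : ℝ≥0) : ℝ) : ℂ) ^ (2 - ((σ : ℝ) : ℂ))‖ ≤ ‖φ₀‖ * ‖cσ‖
    rw [norm_mul, norm_mul, norm_borelHeight_cpow]
    have h1 : (1 : ℝ) ≤ ((borelHeight g : ℝ≥0) : ℝ) := by exact_mod_cast hT.trans hg.le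
    have hle : ((borelHeight g : ℝ≥0) : ℝ) ^ ((2 : ℂ) - ((σ : ℝ) : ℂ)).re ≤ 1 :=
      Real.rpow_le_one_of_one_le_of_nonpos h1 (by simp only [Complex.sub_re, Complex.ofReal_re, Complex.re_ofNat]; linarith)
    calc ‖φ₀‖ * ‖cσ‖ * ((borelHeight g : ℝ≥0) : ℝ) ^ ((2 : ℂ) - ((σ : ℝ) : ℂ)).re ≤ ‖φ₀‖ * ‖cσ‖ * 1 := by gcongr
      _ = ‖φ₀‖ * ‖cσ‖ := mul_one _
  refine ⟨ENNReal.ofReal (‖φ₀‖ * ‖cσ‖), ENNReal.ofReal_lt_top, fun y => ?_⟩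
  -- the terms at `z` and at `σ` have the same norm
  have hnorm : ∀ g : (quasiSplit (↥(maximalRealSubfield L)) L (IsCMField.complexConj L) 3).Adelic,
      ‖({g : (quasiSplit (↥(maximalRealSubfield L)) L (IsCMField.complexConj L) 3).Adelic | borelHeight g ≤ T}.indicator
          (flatSectionU (fun _ : (quasiSplit (↥(maximalRealSubfield L)) L (IsCMField.complexConj L) 3).Adelic => φ₀) z)) g‖ₑ =
        ENNReal.ofReal (‖φ₀‖ * ({g : (quasiSplit (↥(maximalRealSubfield L)) L (IsCMField.complexConj L) 3).Adelic | borelHeight g ≤ T}.indicator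
          (fun g => ((borelHeight g : ℝ≥0) : ℝ) ^ σ) g)) := fun g => by
    rw [← ofReal_norm]
    congr 1
    by_cases hg : g ∈ {g : (quasiSplit (↥(maximalRealSubfield L)) L (IsCMField.complexConj L) 3).Adelic | borelHeight g ≤ T}
    · rw [Set.indicator_of_mem hg, Set.indicator_of_mem hg, flatSectionU_apply, norm_mul, norm_borelHeight_cpow]
    · rw [Set.indicator_of_notMem hg, Set.indicator_of_notMem hg, norm_zero, mul_zero]
  -- the non-negative real terms `r_q = 𝟙_{H≤T} H^σ (q̃ y)` are summable (sub-series of the Godement series at `σ > 2`)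
  set r : Quotient (QuotientGroup.rightRel (arithmeticBorel (↥(maximalRealSubfield L)) L (IsCMField.complexConj L) 3)) → ℝ := fun q =>
    {g : (quasiSplit (↥(maximalRealSubfield L)) L (IsCMField.complexConj L) 3).Adelic | borelHeight g ≤ T}.indicator (fun g => ((borelHeight g : ℝ≥0) : ℝ) ^ σ)
      (((q.out : (quasiSplit (↥(maximalRealSubfield L)) L (IsCMField.complexConj L) 3).arithmeticSubgroup) : (quasiSplit (↥(maximalRealSubfield L)) L (IsCMField.complexConj L) 3).Adelic) * y) with hr
  have hr0 : ∀ q, 0 ≤ r q := fun q => by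
    simp only [hr]
    exact Set.indicator_nonneg (fun g _ => Real.rpow_nonneg (NNReal.coe_nonneg _) σ) _
  have hsumσ : Summable fun q : Quotient (QuotientGroup.rightRel (arithmeticBorel (↥(maximalRealSubfield L)) L (IsCMField.complexConj L) 3)) =>
      fσ (((q.out : (quasiSplit (↥(maximalRealSubfield L)) L (IsCMField.complexConj L) 3).arithmeticSubgroup) : (quasiSplit (↥(maximalRealSubfield L)) L (IsCMField.complexConj L) 3).Adelic) * y) :=
    summable_arithmeticBorelQuot_of_summable hfσB ((summable_eisensteinSeriesU_flatSectionU_cm_three L hσz (φ := fun _ => φ₀) (M := ‖φ₀‖) (fun _ => le_rfl) y).of_norm)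
  have hrle : ∀ q, ‖φ₀‖ * r q ≤ ‖fσ (((q.out : (quasiSplit (↥(maximalRealSubfield L)) L (IsCMField.complexConj L) 3).arithmeticSubgroup) : (quasiSplit (↥(maximalRealSubfield L)) L (IsCMField.complexConj L) 3).Adelic) * y)‖ := fun q => by
    rw [hfσ, flatSectionU_apply, norm_mul, norm_borelHeight_cpow, Complex.ofReal_re]
    simp only [hr]
    by_cases hq : (((q.out : (quasiSplit (↥(maximalRealSubfield L)) L (IsCMField.complexConj L) 3).arithmeticSubgroup) : (quasiSplit (↥(maximalRealSubfield L)) L (IsCMField.complexConj L) 3).Adelic) * y) ∈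
        {g : (quasiSplit (↥(maximalRealSubfield L)) L (IsCMField.complexConj L) 3).Adelic | borelHeight g ≤ T}
    · rw [Set.indicator_of_mem hq]
    · rw [Set.indicator_of_notMem hq, mul_zero]
      exact mul_nonneg (norm_nonneg _) (Real.rpow_nonneg (NNReal.coe_nonneg _) σ)
  have hsumr : Summable fun q => ‖φ₀‖ * r q :=
    Summable.of_nonneg_of_le (fun q => mul_nonneg (norm_nonneg _) (hr0 q)) hrle hsumσ.norm
  -- the indicator series at `σ` IS `φ₀ · Σ r_q`
  have hfσ1 : ∀ g : (quasiSplit (↥(maximalRealSubfield L)) L (IsCMField.complexConj L) 3).Adelic,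
      ({g : (quasiSplit (↥(maximalRealSubfield L)) L (IsCMField.complexConj L) 3).Adelic | borelHeight g ≤ T}.indicator fσ) g =
        φ₀ * (({g : (quasiSplit (↥(maximalRealSubfield L)) L (IsCMField.complexConj L) 3).Adelic | borelHeight g ≤ T}.indicator (fun g => ((borelHeight g : ℝ≥0) : ℝ) ^ σ) g : ℝ) : ℂ) := fun g => by
    by_cases hg : g ∈ {g : (quasiSplit (↥(maximalRealSubfield L)) L (IsCMField.complexConj L) 3).Adelic | borelHeight g ≤ T}
    · rw [Set.indicator_of_mem hg, Set.indicator_of_mem hg, hfσ, flatSectionU_apply, Complex.ofReal_cpow (NNReal.coe_nonneg _)]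
    · rw [Set.indicator_of_notMem hg, Set.indicator_of_notMem hg, Complex.ofReal_zero, mul_zero]
  have hEσ : eisensteinSeriesU ({g : (quasiSplit (↥(maximalRealSubfield L)) L (IsCMField.complexConj L) 3).Adelic | borelHeight g ≤ T}.indicator fσ) y = φ₀ * (((∑' q, r q : ℝ)) : ℂ) := by
    rw [eisensteinSeriesU_eq_tsum_arithmeticBorelQuot (forall_arithmeticBorel_indicator hfσB fun h => h ≤ T) y]
    simp_rw [hfσ1]
    rw [tsum_mul_left, Complex.ofReal_tsum]
  -- LHS = ‖φ₀‖ₑ · Σ r_q = ‖E(𝟙_{H≤T} fσ)(y)‖ₑ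
  have hlhs : (∑' q : Quotient (QuotientGroup.rightRel (arithmeticBorel (↥(maximalRealSubfield L)) L (IsCMField.complexConj L) 3)),
      ‖({g : (quasiSplit (↥(maximalRealSubfield L)) L (IsCMField.complexConj L) 3).Adelic | borelHeight g ≤ T}.indicator
          (flatSectionU (fun _ : (quasiSplit (↥(maximalRealSubfield L)) L (IsCMField.complexConj L) 3).Adelic => φ₀) z))
        (((q.out : (quasiSplit (↥(maximalRealSubfield L)) L (IsCMField.complexConj L) 3).arithmeticSubgroup) : (quasiSplit (↥(maximalRealSubfield L)) L (IsCMField.complexConj L) 3).Adelic) * y)‖ₑ) =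
      ‖eisensteinSeriesU ({g : (quasiSplit (↥(maximalRealSubfield L)) L (IsCMField.complexConj L) 3).Adelic | borelHeight g ≤ T}.indicator fσ) y‖ₑ := by
    simp_rw [hnorm]
    rw [← ENNReal.ofReal_tsum_of_nonneg (fun q => mul_nonneg (norm_nonneg _) (hr0 q)) hsumr, tsum_mul_left, hEσ, ← ofReal_norm, norm_mul, Complex.norm_real,
      Real.norm_of_nonneg (tsum_nonneg hr0)]
  rw [hlhs]
  -- `E(𝟙_{H≤T} fσ) = Λ^T E(fσ) + E(𝟙_{H>T} Mσ)` and the one-term bound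
  have hsumy : Summable fun q : Quotient (orbitRel ↥(borelU ((IsCMField.complexConj L : L ≃ₐ[↥(maximalRealSubfield L)] L) : L →+* L) ((StdForm.antidiagonal 3).over L))
      ↥(unitaryGroupOfForm ((IsCMField.complexConj L : L ≃ₐ[↥(maximalRealSubfield L)] L) : L →+* L) ((StdForm.antidiagonal 3).over L))) =>
      fσ ((quasiSplit (↥(maximalRealSubfield L)) L (IsCMField.complexConj L) 3).toAdelic (q.out : ↥(unitaryGroupOfForm ((IsCMField.complexConj L : L ≃ₐ[↥(maximalRealSubfield L)] L) : L →+* L) ((StdForm.antidiagonal 3).over L))) * y) :=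
    (summable_eisensteinSeriesU_flatSectionU_cm_three L hσz (φ := fun _ => φ₀) (M := ‖φ₀‖) (fun _ => le_rfl) y).of_norm
  have hsplit := truncation_eisensteinSeriesU_eq_three (ν := ν) (𝓕 := 𝓕) hT hfσB hMσB hCTσ hsumy
  have hE1 : eisensteinSeriesU ({g : (quasiSplit (↥(maximalRealSubfield L)) L (IsCMField.complexConj L) 3).Adelic | borelHeight g ≤ T}.indicator fσ) y =
      truncation ν 𝓕 T (eisensteinSeriesU fσ) y + eisensteinSeriesU ({g : (quasiSplit (↥(maximalRealSubfield L)) L (IsCMField.complexConj L) 3).Adelic | T < borelHeight g}.indicator Mσ) y := by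
    rw [hsplit]; ring
  rw [hE1]
  refine (enorm_add_le _ _).trans ?_
  gcongr
  rw [← ofReal_norm]
  exact ENNReal.ofReal_le_ofReal (norm_eisensteinSeriesU_indicator_lt_le siegel_three hT hMσB (mul_nonneg (norm_nonneg _) (norm_nonneg _)) hMσbd y)

variable (μ : Measure (quasiSplit (↥(maximalRealSubfield L)) L (IsCMField.complexConj L) 3).automorphicQuotient) [(quasiSplit (↥(maximalRealSubfield L)) L (IsCMField.complexConj L) 3).IsAutomorphicMeasure μ]

/-- **`⟪φ̂, v⟫ = 0` ON THE TUBE**: for `2 < Re z`, `T ≥ 1`, `ν` Haar on `N(𝔸)` with a fundamental domain `𝓕` of compact closure, parabolic data `𝔓` with `𝔓.radical i = N(𝔸)`, a cusp form `φ ∈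
cuspForms μ 𝔓`, and any `v ∈ L²(μ)` with `v =ᵐ Λ^T E(φ₀H^z)` — provided `Λ^T E(φ₀H^{Re z}) ∈ L²(μ)` (the (Tr) letter at the REAL point, feeding the majorant of the low part): the split ★
`truncation_eisensteinSeriesU_eq_three` + ★ FILE A twice against `Λ = invQuot φ` (★ (β1), `Λ_B ≡ 0`), `hL1` by ★ FILE B + Hölder. [cite: MoeglinWaldspurger1995, II.1.8, IV.1.11] [cite: BernsteinLapid2019, §4 Claim 2] -/
theorem inner_cuspFormsToLp_eq_zero_of_ae_eq_truncation_cm_three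
    (ν : Measure ↥(adelicUnipotent (↥(maximalRealSubfield L)) L (IsCMField.complexConj L) 3)) [ν.IsHaarMeasure]
    {𝓕 : Set ↥(adelicUnipotent (↥(maximalRealSubfield L)) L (IsCMField.complexConj L) 3)}
    (h𝓕N : IsFundamentalDomain ↥(rationalUnipotent (↥(maximalRealSubfield L)) L (IsCMField.complexConj L) 3) 𝓕 ν) (h𝓕c : IsCompact (closure 𝓕))
    (𝔓 : (quasiSplit (↥(maximalRealSubfield L)) L (IsCMField.complexConj L) 3).ParabolicUnipotentData) (i : 𝔓.ι)
    (h𝔓 : 𝔓.radical i = adelicUnipotent (↥(maximalRealSubfield L)) L (IsCMField.complexConj L) 3)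
    (φ₀ : ℂ) {T : ℝ≥0} (hT : 1 ≤ T) {z : ℂ} (hz : 2 < z.re)
    (v : (quasiSplit (↥(maximalRealSubfield L)) L (IsCMField.complexConj L) 3).L2 μ)
    (hv : (v : (quasiSplit (↥(maximalRealSubfield L)) L (IsCMField.complexConj L) 3).automorphicQuotient → ℂ) =ᵐ[μ]
      (quasiSplit (↥(maximalRealSubfield L)) L (IsCMField.complexConj L) 3).quotFun
        (truncation ν 𝓕 T (eisensteinSeriesU (flatSectionU (fun _ : (quasiSplit (↥(maximalRealSubfield L)) L (IsCMField.complexConj L) 3).Adelic => φ₀) z))))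
    (hL2 : MemLp ((quasiSplit (↥(maximalRealSubfield L)) L (IsCMField.complexConj L) 3).quotFun
      (truncation ν 𝓕 T (eisensteinSeriesU (flatSectionU (fun _ : (quasiSplit (↥(maximalRealSubfield L)) L (IsCMField.complexConj L) 3).Adelic => φ₀) ((z.re : ℝ) : ℂ))))) 2 μ)
    (φ : ↥((quasiSplit (↥(maximalRealSubfield L)) L (IsCMField.complexConj L) 3).cuspForms μ 𝔓)) :
    ⟪(quasiSplit (↥(maximalRealSubfield L)) L (IsCMField.complexConj L) 3).cuspFormsToLp μ 𝔓 φ, v⟫_ℂ = 0 := by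
  haveI := t2Space_adeleRing_of_numberField L
  haveI := locallyCompactSpace_adeleRing' L
  haveI := secondCountableTopology_adeleRing L
  haveI : T2Space (quasiSplit (↥(maximalRealSubfield L)) L (IsCMField.complexConj L) 3).Adelic :=
    inferInstanceAs (T2Space (adelic (↥(maximalRealSubfield L)) L (IsCMField.complexConj L) 3 ((StdForm.antidiagonal 3).over L)))
  haveI : LocallyCompactSpace (quasiSplit (↥(maximalRealSubfield L)) L (IsCMField.complexConj L) 3).Adelic :=
    inferInstanceAs (LocallyCompactSpace (adelic (↥(maximalRealSubfield L)) L (IsCMField.complexConj L) 3 ((StdForm.antidiagonal 3).over L)))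
  haveI : SecondCountableTopology (quasiSplit (↥(maximalRealSubfield L)) L (IsCMField.complexConj L) 3).Adelic :=
    inferInstanceAs (SecondCountableTopology (adelic (↥(maximalRealSubfield L)) L (IsCMField.complexConj L) 3 ((StdForm.antidiagonal 3).over L)))
  have hc : (IsCMField.complexConj L) * (IsCMField.complexConj L) = 1 := AlgEquiv.ext fun x => IsCMField.complexConj_apply_apply L x
  have hc1 : (IsCMField.complexConj L) ≠ 1 := IsCMField.complexConj_ne_one L
  haveI : (haar : Measure (quasiSplit (↥(maximalRealSubfield L)) L (IsCMField.complexConj L) 3).Adelic).IsMulRightInvariant :=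
    forall_isHaarMeasure_isMulRightInvariant_quasiSplit_cm L (by norm_num : 2 ≤ 3) haar inferInstance
  haveI : (haar : Measure (quasiSplit (↥(maximalRealSubfield L)) L (IsCMField.complexConj L) 3).Adelic).IsInvInvariant := isInvInvariant_of_isMulRightInvariant _
  haveI : ν.IsInvInvariant := K2E1HeisenbergHaarU3.isInvInvariant_of_isHaarMeasure_adelicUnipotent_three hc ν
  have h𝓕₀ : ν 𝓕 ≠ 0 := measure_ne_zero_of_isFundamentalDomain_rationalUnipotent ν h𝓕N
  have h𝓕top : ν 𝓕 ≠ ∞ := ((measure_mono subset_closure).trans_lt h𝓕c.measure_lt_top).ne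
  obtain ⟨β, hβ⟩ := exists_isCoveringWeight_arithmeticBorel (F := (↥(maximalRealSubfield L))) (E := L) (c := (IsCMField.complexConj L)) (N := 3)
  -- the section, the constant term on the tube, the tail function
  set f : (quasiSplit (↥(maximalRealSubfield L)) L (IsCMField.complexConj L) 3).Adelic → ℂ :=
    flatSectionU (fun _ : (quasiSplit (↥(maximalRealSubfield L)) L (IsCMField.complexConj L) 3).Adelic => φ₀) z with hf
  obtain ⟨cz, hcz⟩ : ∃ cz : ℂ, ∀ g : (quasiSplit (↥(maximalRealSubfield L)) L (IsCMField.complexConj L) 3).Adelic,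
      borelConstantTerm ν 𝓕 (eisensteinSeriesU f) g = φ₀ * ((((borelHeight g : ℝ≥0) : ℝ) : ℂ) ^ z + cz * (((borelHeight g : ℝ≥0) : ℝ) : ℂ) ^ (2 - z)) :=
    ⟨_, fun g => borelConstantTerm_sphericalEisenstein_cm_three L ν h𝓕N h𝓕c φ₀ hz g⟩
  set Mf : (quasiSplit (↥(maximalRealSubfield L)) L (IsCMField.complexConj L) 3).Adelic → ℂ := fun g => φ₀ * cz * (((borelHeight g : ℝ≥0) : ℝ) : ℂ) ^ (2 - z) with hMf
  set f₁ : (quasiSplit (↥(maximalRealSubfield L)) L (IsCMField.complexConj L) 3).Adelic → ℂ :=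
    {g : (quasiSplit (↥(maximalRealSubfield L)) L (IsCMField.complexConj L) 3).Adelic | borelHeight g ≤ T}.indicator f with hf₁
  set f₂ : (quasiSplit (↥(maximalRealSubfield L)) L (IsCMField.complexConj L) 3).Adelic → ℂ :=
    {g : (quasiSplit (↥(maximalRealSubfield L)) L (IsCMField.complexConj L) 3).Adelic | T < borelHeight g}.indicator Mf with hf₂
  have hfB : ∀ b ∈ arithmeticBorel (↥(maximalRealSubfield L)) L (IsCMField.complexConj L) 3, ∀ x : (quasiSplit (↥(maximalRealSubfield L)) L (IsCMField.complexConj L) 3).Adelic,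
      f ((b : (quasiSplit (↥(maximalRealSubfield L)) L (IsCMField.complexConj L) 3).Adelic) * x) = f x := fun b hb x => by
    simp only [hf, flatSectionU_apply, K2E1TruncatedEisensteinExplicit.borelHeight_arithmeticBorel_mul hb]
  have hMfB : ∀ b ∈ arithmeticBorel (↥(maximalRealSubfield L)) L (IsCMField.complexConj L) 3, ∀ x : (quasiSplit (↥(maximalRealSubfield L)) L (IsCMField.complexConj L) 3).Adelic,
      Mf ((b : (quasiSplit (↥(maximalRealSubfield L)) L (IsCMField.complexConj L) 3).Adelic) * x) = Mf x := fun b hb x => by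
    simp only [hMf, K2E1TruncatedEisensteinExplicit.borelHeight_arithmeticBorel_mul hb]
  have hf₁B := forall_arithmeticBorel_indicator hfB fun h => h ≤ T
  have hf₂B := forall_arithmeticBorel_indicator hMfB fun h => T < h
  have hCT : ∀ x : (quasiSplit (↥(maximalRealSubfield L)) L (IsCMField.complexConj L) 3).Adelic, T < borelHeight x →
      borelConstantTerm ν 𝓕 (eisensteinSeriesU f) x = f x + Mf x := fun x _ => by
    rw [hcz x, hf, flatSectionU_apply, hMf]; ring
  -- measurability and `N(𝔸)`-invariance
  have hfm : Measurable f := measurable_flatSectionU measurable_const _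
  have hMfm : Measurable Mf := (continuous_const.mul (continuous_borelHeight_cpow _)).measurable
  have hsle : MeasurableSet {g : (quasiSplit (↥(maximalRealSubfield L)) L (IsCMField.complexConj L) 3).Adelic | borelHeight g ≤ T} :=
    measurableSet_le continuous_borelHeight.measurable measurable_const
  have hslt : MeasurableSet {g : (quasiSplit (↥(maximalRealSubfield L)) L (IsCMField.complexConj L) 3).Adelic | T < borelHeight g} :=
    measurableSet_lt measurable_const continuous_borelHeight.measurable
  have hf₁m : Measurable f₁ := hfm.indicator hsle
  have hf₂m : Measurable f₂ := hMfm.indicator hslt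
  have hf₁N : ∀ (u : ↥(adelicUnipotent (↥(maximalRealSubfield L)) L (IsCMField.complexConj L) 3)) (g : (quasiSplit (↥(maximalRealSubfield L)) L (IsCMField.complexConj L) 3).Adelic),
      f₁ ((u : (quasiSplit (↥(maximalRealSubfield L)) L (IsCMField.complexConj L) 3).Adelic) * g) = f₁ g := fun u g => by
    simp only [hf₁, hf, Set.indicator_apply, Set.mem_setOf_eq, flatSectionU_apply, borelHeight_unipotent_mul u.2]
  have hf₂N : ∀ (u : ↥(adelicUnipotent (↥(maximalRealSubfield L)) L (IsCMField.complexConj L) 3)) (g : (quasiSplit (↥(maximalRealSubfield L)) L (IsCMField.complexConj L) 3).Adelic),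
      f₂ ((u : (quasiSplit (↥(maximalRealSubfield L)) L (IsCMField.complexConj L) 3).Adelic) * g) = f₂ g := fun u g => by
    simp only [hf₂, hMf, Set.indicator_apply, Set.mem_setOf_eq, borelHeight_unipotent_mul u.2]
  -- the lift `Λ = invQuot φ` of the cusp form (★ (β1))
  obtain ⟨hΛm, hΛinv, hΛq, hΛB⟩ := invQuot_package_of_mem_cuspForms 𝔓 i h𝔓 ν h𝓕N φ.2
  have hΛG : ∀ (γ : (quasiSplit (↥(maximalRealSubfield L)) L (IsCMField.complexConj L) 3).arithmeticSubgroup) (x : (quasiSplit (↥(maximalRealSubfield L)) L (IsCMField.complexConj L) 3).Adelic),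
      invQuot (quasiSplit (↥(maximalRealSubfield L)) L (IsCMField.complexConj L) 3) (φ : (quasiSplit (↥(maximalRealSubfield L)) L (IsCMField.complexConj L) 3).automorphicQuotient → ℂ)
        ((γ : (quasiSplit (↥(maximalRealSubfield L)) L (IsCMField.complexConj L) 3).Adelic) * x) =
      invQuot (quasiSplit (↥(maximalRealSubfield L)) L (IsCMField.complexConj L) 3) (φ : (quasiSplit (↥(maximalRealSubfield L)) L (IsCMField.complexConj L) 3).automorphicQuotient → ℂ) x :=
    fun γ x => hΛinv _ ((quasiSplit (↥(maximalRealSubfield L)) L (IsCMField.complexConj L) 3).arithmeticSubgroup_le_quotientSubgroup γ.2) x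
  have hq : ∀ x : (quasiSplit (↥(maximalRealSubfield L)) L (IsCMField.complexConj L) 3).automorphicQuotient,
      invQuot (quasiSplit (↥(maximalRealSubfield L)) L (IsCMField.complexConj L) 3) (φ : (quasiSplit (↥(maximalRealSubfield L)) L (IsCMField.complexConj L) 3).automorphicQuotient → ℂ)
        (Quotient.out (x : (quasiSplit (↥(maximalRealSubfield L)) L (IsCMField.complexConj L) 3).Adelic ⧸ (quasiSplit (↥(maximalRealSubfield L)) L (IsCMField.complexConj L) 3).quotientSubgroup))⁻¹ =
      (φ : (quasiSplit (↥(maximalRealSubfield L)) L (IsCMField.complexConj L) 3).automorphicQuotient → ℂ) x := fun x => congrFun hΛq x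
  have hφ2 : MemLp (φ : (quasiSplit (↥(maximalRealSubfield L)) L (IsCMField.complexConj L) 3).automorphicQuotient → ℂ) 2 μ := AdelicGroupData.memLp_of_mem_cuspForms φ.2
  have hφ1 : Integrable (φ : (quasiSplit (↥(maximalRealSubfield L)) L (IsCMField.complexConj L) 3).automorphicQuotient → ℂ) μ := hφ2.integrable one_le_two
  have hφ2' : ∫⁻ x, ‖(φ : (quasiSplit (↥(maximalRealSubfield L)) L (IsCMField.complexConj L) 3).automorphicQuotient → ℂ) x‖ₑ ^ (2 : ℝ) ∂μ < ∞ := by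
    have h := lintegral_rpow_enorm_lt_top_of_eLpNorm_lt_top (p := (2 : ℝ≥0∞)) (by norm_num) (by norm_num) hφ2.2
    simpa only [ENNReal.toReal_ofNat] using h
  -- the `L¹` letter for `f₂` (one coset above the floor)
  have hMfbd : ∀ g : (quasiSplit (↥(maximalRealSubfield L)) L (IsCMField.complexConj L) 3).Adelic, T < borelHeight g → ‖Mf g‖ ≤ ‖φ₀‖ * ‖cz‖ := fun g hg => by
    rw [hMf]
    change ‖φ₀ * cz * (((borelHeight g : ℝ≥0) : ℝ) : ℂ) ^ (2 - z)‖ ≤ ‖φ₀‖ * ‖cz‖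
    rw [norm_mul, norm_mul, norm_borelHeight_cpow]
    have h1 : (1 : ℝ) ≤ ((borelHeight g : ℝ≥0) : ℝ) := by exact_mod_cast hT.trans hg.le
    have hle : ((borelHeight g : ℝ≥0) : ℝ) ^ ((2 : ℂ) - z).re ≤ 1 :=
      Real.rpow_le_one_of_one_le_of_nonpos h1 (by simp only [Complex.sub_re, Complex.re_ofNat]; linarith)
    calc ‖φ₀‖ * ‖cz‖ * ((borelHeight g : ℝ≥0) : ℝ) ^ ((2 : ℂ) - z).re ≤ ‖φ₀‖ * ‖cz‖ * 1 := by gcongr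
      _ = ‖φ₀‖ * ‖cz‖ := mul_one _
  have hL1₂ : ∫⁻ g, β g * ‖f₂ g * conj (invQuot (quasiSplit (↥(maximalRealSubfield L)) L (IsCMField.complexConj L) 3)
      (φ : (quasiSplit (↥(maximalRealSubfield L)) L (IsCMField.complexConj L) 3).automorphicQuotient → ℂ) g)‖ₑ ∂haar < ∞ := by
    refine lintegral_weight_enorm_mul_lt_top_of_lintegral_quotient_lt_top μ haar hβ hf₂m hΛm hf₂B hΛG ?_
    calc ∫⁻ x : (quasiSplit (↥(maximalRealSubfield L)) L (IsCMField.complexConj L) 3).automorphicQuotient,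
          (∑' q : Quotient (QuotientGroup.rightRel (arithmeticBorel (↥(maximalRealSubfield L)) L (IsCMField.complexConj L) 3)),
            ‖f₂ (((q.out : (quasiSplit (↥(maximalRealSubfield L)) L (IsCMField.complexConj L) 3).arithmeticSubgroup) : (quasiSplit (↥(maximalRealSubfield L)) L (IsCMField.complexConj L) 3).Adelic) *
              (Quotient.out x : (quasiSplit (↥(maximalRealSubfield L)) L (IsCMField.complexConj L) 3).Adelic)⁻¹)‖ₑ) *
            ‖invQuot (quasiSplit (↥(maximalRealSubfield L)) L (IsCMField.complexConj L) 3) (φ : (quasiSplit (↥(maximalRealSubfield L)) L (IsCMField.complexConj L) 3).automorphicQuotient → ℂ)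
              (Quotient.out x : (quasiSplit (↥(maximalRealSubfield L)) L (IsCMField.complexConj L) 3).Adelic)⁻¹‖ₑ ∂μ
        ≤ ∫⁻ x, ENNReal.ofReal (‖φ₀‖ * ‖cz‖) * ‖(φ : (quasiSplit (↥(maximalRealSubfield L)) L (IsCMField.complexConj L) 3).automorphicQuotient → ℂ) x‖ₑ ∂μ :=
          lintegral_mono fun x => by
            rw [hq x]
            exact mul_le_mul' (tsum_enorm_indicator_lt_le siegel_three hT (mul_nonneg (norm_nonneg _) (norm_nonneg _)) hMfbd _) le_rfl
      _ < ∞ := by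
          rw [lintegral_const_mul' _ _ ENNReal.ofReal_ne_top]
          exact ENNReal.mul_lt_top ENNReal.ofReal_lt_top hφ1.2
  -- the `L¹` letter for `f₁` (majorant through the real point, Hölder)
  obtain ⟨C, hC, hmaj⟩ := exists_tsum_enorm_lowIndicator_le_cm_three L ν h𝓕N h𝓕c φ₀ hT hz
  have hL1₁ : ∫⁻ g, β g * ‖f₁ g * conj (invQuot (quasiSplit (↥(maximalRealSubfield L)) L (IsCMField.complexConj L) 3)
      (φ : (quasiSplit (↥(maximalRealSubfield L)) L (IsCMField.complexConj L) 3).automorphicQuotient → ℂ) g)‖ₑ ∂haar < ∞ := by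
    refine lintegral_weight_enorm_mul_lt_top_of_lintegral_quotient_lt_top μ haar hβ hf₁m hΛm hf₁B hΛG ?_
    have hum : AEMeasurable (fun x => ‖(quasiSplit (↥(maximalRealSubfield L)) L (IsCMField.complexConj L) 3).quotFun
        (truncation ν 𝓕 T (eisensteinSeriesU (flatSectionU (fun _ : (quasiSplit (↥(maximalRealSubfield L)) L (IsCMField.complexConj L) 3).Adelic => φ₀) ((z.re : ℝ) : ℂ)))) x‖ₑ) μ :=
      hL2.1.aemeasurable.enorm
    have hφm : AEMeasurable (fun x => ‖(φ : (quasiSplit (↥(maximalRealSubfield L)) L (IsCMField.complexConj L) 3).automorphicQuotient → ℂ) x‖ₑ) μ := hφ2.1.aemeasurable.enorm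
    have hH := ENNReal.lintegral_mul_le_Lp_mul_Lq μ Real.HolderConjugate.two_two hum hφm
    have hfinH : ∫⁻ x, ‖(quasiSplit (↥(maximalRealSubfield L)) L (IsCMField.complexConj L) 3).quotFun
        (truncation ν 𝓕 T (eisensteinSeriesU (flatSectionU (fun _ : (quasiSplit (↥(maximalRealSubfield L)) L (IsCMField.complexConj L) 3).Adelic => φ₀) ((z.re : ℝ) : ℂ)))) x‖ₑ *
        ‖(φ : (quasiSplit (↥(maximalRealSubfield L)) L (IsCMField.complexConj L) 3).automorphicQuotient → ℂ) x‖ₑ ∂μ < ∞ := by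
      refine lt_of_le_of_lt hH (ENNReal.mul_lt_top ?_ ?_)
      · refine ENNReal.rpow_lt_top_of_nonneg (by norm_num) (lt_top_iff_ne_top.1 ?_)
        have h := lintegral_rpow_enorm_lt_top_of_eLpNorm_lt_top (p := (2 : ℝ≥0∞)) (by norm_num) (by norm_num) hL2.2
        simpa only [ENNReal.toReal_ofNat] using h
      · exact ENNReal.rpow_lt_top_of_nonneg (by norm_num) (lt_top_iff_ne_top.1 hφ2')
    calc ∫⁻ x : (quasiSplit (↥(maximalRealSubfield L)) L (IsCMField.complexConj L) 3).automorphicQuotient,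
          (∑' q : Quotient (QuotientGroup.rightRel (arithmeticBorel (↥(maximalRealSubfield L)) L (IsCMField.complexConj L) 3)),
            ‖f₁ (((q.out : (quasiSplit (↥(maximalRealSubfield L)) L (IsCMField.complexConj L) 3).arithmeticSubgroup) : (quasiSplit (↥(maximalRealSubfield L)) L (IsCMField.complexConj L) 3).Adelic) *
              (Quotient.out x : (quasiSplit (↥(maximalRealSubfield L)) L (IsCMField.complexConj L) 3).Adelic)⁻¹)‖ₑ) *
            ‖invQuot (quasiSplit (↥(maximalRealSubfield L)) L (IsCMField.complexConj L) 3) (φ : (quasiSplit (↥(maximalRealSubfield L)) L (IsCMField.complexConj L) 3).automorphicQuotient → ℂ)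
              (Quotient.out x : (quasiSplit (↥(maximalRealSubfield L)) L (IsCMField.complexConj L) 3).Adelic)⁻¹‖ₑ ∂μ
        ≤ ∫⁻ x, (‖(quasiSplit (↥(maximalRealSubfield L)) L (IsCMField.complexConj L) 3).quotFun
              (truncation ν 𝓕 T (eisensteinSeriesU (flatSectionU (fun _ : (quasiSplit (↥(maximalRealSubfield L)) L (IsCMField.complexConj L) 3).Adelic => φ₀) ((z.re : ℝ) : ℂ)))) x‖ₑ *
              ‖(φ : (quasiSplit (↥(maximalRealSubfield L)) L (IsCMField.complexConj L) 3).automorphicQuotient → ℂ) x‖ₑ +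
            C * ‖(φ : (quasiSplit (↥(maximalRealSubfield L)) L (IsCMField.complexConj L) 3).automorphicQuotient → ℂ) x‖ₑ) ∂μ :=
          lintegral_mono fun x => by
            rw [hq x, ← add_mul]
            exact mul_le_mul' (hmaj _) le_rfl
      _ < ∞ := by
          have hm2 : AEMeasurable (fun x => ‖(quasiSplit (↥(maximalRealSubfield L)) L (IsCMField.complexConj L) 3).quotFun
              (truncation ν 𝓕 T (eisensteinSeriesU (flatSectionU (fun _ : (quasiSplit (↥(maximalRealSubfield L)) L (IsCMField.complexConj L) 3).Adelic => φ₀) ((z.re : ℝ) : ℂ)))) x‖ₑ *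
              ‖(φ : (quasiSplit (↥(maximalRealSubfield L)) L (IsCMField.complexConj L) 3).automorphicQuotient → ℂ) x‖ₑ) μ := hum.mul hφm
          rw [lintegral_add_left' hm2, lintegral_const_mul' _ _ hC.ne]
          exact ENNReal.add_lt_top.2 ⟨hfinH, ENNReal.mul_lt_top hC hφ1.2⟩
  -- ★ FILE A, twice
  obtain ⟨-, -, hint₁, -⟩ := integrable_and_integral_quotFun_eisensteinSeriesU_mul_conj_eq_three hc hc1 μ haar ν h𝓕N h𝓕₀ h𝓕top hβ hf₁m hΛm hf₁N hf₁B hΛG hL1₁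
  obtain ⟨-, -, hint₂, -⟩ := integrable_and_integral_quotFun_eisensteinSeriesU_mul_conj_eq_three hc hc1 μ haar ν h𝓕N h𝓕₀ h𝓕top hβ hf₂m hΛm hf₂N hf₂B hΛG hL1₂
  have h0₁ := integral_quotFun_eisensteinSeriesU_mul_conj_eq_zero_three hc hc1 μ haar ν h𝓕N h𝓕₀ h𝓕top hβ hf₁m hΛm hf₁N hf₁B hΛG hL1₁ (ae_of_all _ hΛB)
  have h0₂ := integral_quotFun_eisensteinSeriesU_mul_conj_eq_zero_three hc hc1 μ haar ν h𝓕N h𝓕₀ h𝓕top hβ hf₂m hΛm hf₂N hf₂B hΛG hL1₂ (ae_of_all _ hΛB)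
  rw [hΛq] at hint₁ hint₂ h0₁ h0₂
  -- the split, pointwise
  have hsum : ∀ y : (quasiSplit (↥(maximalRealSubfield L)) L (IsCMField.complexConj L) 3).Adelic,
      Summable fun q : Quotient (orbitRel ↥(borelU ((IsCMField.complexConj L : L ≃ₐ[↥(maximalRealSubfield L)] L) : L →+* L) ((StdForm.antidiagonal 3).over L))
        ↥(unitaryGroupOfForm ((IsCMField.complexConj L : L ≃ₐ[↥(maximalRealSubfield L)] L) : L →+* L) ((StdForm.antidiagonal 3).over L))) =>
        f ((quasiSplit (↥(maximalRealSubfield L)) L (IsCMField.complexConj L) 3).toAdelic (q.out : ↥(unitaryGroupOfForm ((IsCMField.complexConj L : L ≃ₐ[↥(maximalRealSubfield L)] L) : L →+* L) ((StdForm.antidiagonal 3).over L))) * y) :=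
    fun y => (summable_eisensteinSeriesU_flatSectionU_cm_three L hz (φ := fun _ => φ₀) (M := ‖φ₀‖) (fun _ => le_rfl) y).of_norm
  have hsplit : ∀ x : (quasiSplit (↥(maximalRealSubfield L)) L (IsCMField.complexConj L) 3).automorphicQuotient,
      (quasiSplit (↥(maximalRealSubfield L)) L (IsCMField.complexConj L) 3).quotFun (truncation ν 𝓕 T (eisensteinSeriesU f)) x =
        (quasiSplit (↥(maximalRealSubfield L)) L (IsCMField.complexConj L) 3).quotFun (eisensteinSeriesU f₁) x -
          (quasiSplit (↥(maximalRealSubfield L)) L (IsCMField.complexConj L) 3).quotFun (eisensteinSeriesU f₂) x := fun x =>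
    truncation_eisensteinSeriesU_eq_three (ν := ν) (𝓕 := 𝓕) hT hfB hMfB hCT (hsum _)
  -- assemble
  rw [AdelicGroupData.cuspFormsToLp_apply, MeasureTheory.L2.inner_def]
  have hae : (fun x : (quasiSplit (↥(maximalRealSubfield L)) L (IsCMField.complexConj L) 3).automorphicQuotient =>
      ⟪(hφ2.toLp (φ : (quasiSplit (↥(maximalRealSubfield L)) L (IsCMField.complexConj L) 3).automorphicQuotient → ℂ)) x, v x⟫_ℂ) =ᵐ[μ]
      fun x => (quasiSplit (↥(maximalRealSubfield L)) L (IsCMField.complexConj L) 3).quotFun (eisensteinSeriesU f₁) x *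
          conj ((φ : (quasiSplit (↥(maximalRealSubfield L)) L (IsCMField.complexConj L) 3).automorphicQuotient → ℂ) x) -
        (quasiSplit (↥(maximalRealSubfield L)) L (IsCMField.complexConj L) 3).quotFun (eisensteinSeriesU f₂) x *
          conj ((φ : (quasiSplit (↥(maximalRealSubfield L)) L (IsCMField.complexConj L) 3).automorphicQuotient → ℂ) x) := by
    filter_upwards [hφ2.coeFn_toLp, hv] with x hx hvx
    rw [hx, hvx, RCLike.inner_apply, hsplit x]
    ring
  rw [integral_congr_ae hae, integral_sub hint₁ hint₂, h0₁, h0₂, sub_zero]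


end Tube

end Summit.HodgeConjecture.HodgeConjecture.Cruxes.H413.K2E1TruncatedEisensteinCuspOrthogonalCMThree

end
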